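import Mathlib
import Literature.NumberTheory.LFunctions.ZetaTruncationUniform
import Literature.NumberTheory.LFunctions.RHWave0HardyProofs
import Literature.NumberTheory.LFunctions.ZetaRealAxis
import Literature.Analysis.FunctionSpaces.PlancherelL1L2
import HarnessLib

/-!
# THEOREM U0 — the lattice-sum uncertainty ratio of time-limited functions is DEGENERATE

Handoff track (ROUTE 1′), prove-1 gen14, ATTEMPT-21. idea-1 gen23 (IDEAS-prolate §127.2 (F-iv),
§127.4 U1) typed the stand-alone target
`μ_min(λ) := inf { ∫_0^{1/λ} |Σ_{n≥1} f(nu)|² du / ∫_{|ξ|≥λ} |f̂(ξ)|² dξ : f even, f(0) = 0 = ∫f,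
supp f ⊂ [-λ, λ], f ≠ 0 }` and conjectured `ℓ·μ_min(λ) ≥ m₀ > 0`. We prove `μ_min(λ) = 0` for every
`λ ≥ 1`: for every `ε > 0` there is an admissible `F` (even, `F 0 = 0`, `∫ F = 0`, supported in
`[-λ, λ]`, in `L¹ ∩ L²`) with `latticeTail λ F ≤ ε · leakage λ F` and `0 < leakage λ F`.
THIS FILE (1/3): the objects `dilationSum`, `latticeTail`, `leakage`; the witness `F_η`; the
closed form of its dilation sum as a difference of partial sums `A(N) = Σ_{n≤N} n^{-ρ}`
(`dilationSum_F`); and FACT Z, the remainder bound `‖A(N) - N^{1-ρ}/(1-ρ)‖ ≤ 6 N^{-1/2}` at a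
critical zero (`norm_A_sub_main_le`, from the tree's Titchmarsh (4.11.1)) with its uniform
version. Files 2/3 (`HandoffLatticeUncertaintyPointwise`) and 3/3
(`HandoffLatticeUncertaintyDegenerate`) carry the pointwise bound and the theorem.

The witnesses are the Báez-Duarte–Balazard–Landreau–Saias / Burnol Nyman–Beurling test vectors
transplanted: with `ρ = 1/2 + iγ` a zero of `ζ` ON the critical line (Hardy 1914, tree theorem
`hardy_infinite_zeros_on_critical_line_holds`) and `w = 1 - ρ`,
`G_η(x) = x^{-ρ}·(1[η ≤ x ≤ 1] - κ_η·1[1/2 ≤ x ≤ 1])`, `κ_η = (1 - η^w)/(1 - (1/2)^w)` (so `∫ G_η = 0`),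
`F_η(x) = G_η(x) + G_η(-x)`. Below the window the lattice sums of `x^{-ρ}` are complete partial sums
`A(N) = Σ_{n≤N} n^{-ρ}` of `ζ(ρ)`; Titchmarsh's truncation formula (4.11.1) (tree theorem
`norm_zeta_sub_sum_add_le_uniform`) with `ζ(ρ) = 0` gives `A(N) = N^w/w + O(N^{-1/2})`, and the
vanishing integral kills the remaining `u⁻¹` terms, so the lattice tail `∫_0^{1} |Σ_n F_η(nu)|² du`
is bounded UNIFORMLY in `η`, while the out-of-band energy is `≥ log(1/(2η)) - 8λ‖G_η‖₁²` by
Plancherel (`L¹ ∩ L²`, tree) and `|𝓕 F| ≤ ‖F‖₁`. Nothing here bears on the truth of RH: the theorem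
is a statement about the lattice sums of one explicit family of functions.

References: L. Báez-Duarte, M. Balazard, B. Landreau, E. Saias, Adv. Math. 149 (2000) 130–144;
J.-F. Burnol, Forum Math. 16 (2004) 789–840, §5; E. C. Titchmarsh, *The Theory of the Riemann
Zeta-Function*, Thm 4.11.
-/

set_option linter.dupNamespace false

noncomputable section

open Complex MeasureTheory Set Filter Finset
open scoped Real FourierTransform

namespace Summit.RiemannHypothesis.RiemannHypothesis.Theorems

namespace LatticeUncertainty

/-! ## The objects of (U-LATTICE) -/

/-- The dilation (lattice) sum `θ_F(u) = Σ_{1 ≤ n ≤ ⌊λ/u⌋} F(nu)`; for `F` supported in `[-λ, λ]`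
and `u > 0` this is `Σ_{n ≥ 1} F(nu)` (IDEAS-prolate §127.0). -/
def dilationSum (lam : ℝ) (F : ℝ → ℂ) (u : ℝ) : ℂ :=
  ∑ n ∈ Finset.Icc 1 ⌊lam / u⌋₊, F (n * u)

/-- The lattice tail below the window, `T_λ(F) = ∫_0^{1/λ} |θ_F(u)|² du` (IDEAS-prolate §127.0). -/
def latticeTail (lam : ℝ) (F : ℝ → ℂ) : ℝ :=
  ∫ u in Set.Ioc 0 (1 / lam), ‖dilationSum lam F u‖ ^ 2

/-- Out-of-band spectral mass `∫_{|ξ| ≥ λ} |𝓕 F(ξ)|² dξ` (Slepian leakage; verbatim the `leakage` of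
idea-1's g22 `HandoffProlateDomination.lean`). -/
def leakage (lam : ℝ) (F : ℝ → ℂ) : ℝ :=
  ∫ ξ in {ξ : ℝ | lam ≤ |ξ|}, ‖𝓕 F ξ‖ ^ 2

/-! ## Partial sums of `ζ(ρ)` and the witness -/

/-- `A(N) = Σ_{1 ≤ n ≤ N} n^{-ρ}`. -/
def A (ρ : ℂ) (N : ℕ) : ℂ := ∑ n ∈ Finset.Icc 1 N, (n : ℂ) ^ (-ρ)

/-- The monomial piece `m_{a,b}(x) = x^{-ρ}·1[a ≤ x ≤ b]`. -/
def mono (ρ : ℂ) (a b x : ℝ) : ℂ := if a ≤ x ∧ x ≤ b then (x : ℂ) ^ (-ρ) else 0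

/-- `κ_η = (1 - η^{1-ρ}) / (1 - (1/2)^{1-ρ})`, chosen so that `∫ G_η = 0`. -/
def kappa (ρ : ℂ) (η : ℝ) : ℂ := (1 - (η : ℂ) ^ (1 - ρ)) / (1 - ((1 / 2 : ℝ) : ℂ) ^ (1 - ρ))

/-- The one-sided witness `G_η = m_{η,1} - κ_η m_{1/2,1}`. -/
def G (ρ : ℂ) (η x : ℝ) : ℂ := mono ρ η 1 x - kappa ρ η * mono ρ (1 / 2) 1 x

/-- The witness `F_η(x) = G_η(x) + G_η(-x)` (even). -/
def F (ρ : ℂ) (η x : ℝ) : ℂ := G ρ η x + G ρ η (-x)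

section basic

variable {ρ : ℂ} {η : ℝ}

/-- Outside `[a, b]` the monomial piece vanishes. -/
theorem mono_of_not_mem {a b x : ℝ} (h : ¬ (a ≤ x ∧ x ≤ b)) : mono ρ a b x = 0 := by
  simp [mono, h]

/-- For `a > 0` the monomial piece vanishes on the negative half-line. -/
theorem mono_neg_of_pos {a b x : ℝ} (ha : 0 < a) (hx : 0 ≤ x) : mono ρ a b (-x) = 0 :=
  mono_of_not_mem fun h ↦ by linarith [h.1]

/-- `G_η` vanishes on `(-∞, 0]`. -/
theorem G_of_neg {x : ℝ} (hη : 0 < η) (hx : x ≤ 0) : G ρ η x = 0 := by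
  have h1 : mono ρ η 1 x = 0 := mono_of_not_mem fun h ↦ by linarith [h.1]
  have h2 : mono ρ (1 / 2) 1 x = 0 := mono_of_not_mem fun h ↦ by linarith [h.1]
  simp only [G, h1, h2, mul_zero, sub_zero]

/-- `G_η` vanishes beyond `1`. -/
theorem G_of_gt_one {x : ℝ} (hx : 1 < x) : G ρ η x = 0 := by
  have h1 : mono ρ η 1 x = 0 := mono_of_not_mem fun h ↦ by linarith [h.2]
  have h2 : mono ρ (1 / 2) 1 x = 0 := mono_of_not_mem fun h ↦ by linarith [h.2]
  simp only [G, h1, h2, mul_zero, sub_zero]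

/-- `G_η` vanishes below `η` (for `η ≤ 1/2`). -/
theorem G_of_lt {x : ℝ} (hη : η ≤ 1 / 2) (hx : x < η) : G ρ η x = 0 := by
  have h1 : mono ρ η 1 x = 0 := mono_of_not_mem fun h ↦ by linarith [h.1]
  have h2 : mono ρ (1 / 2) 1 x = 0 := mono_of_not_mem fun h ↦ by linarith [h.1]
  simp only [G, h1, h2, mul_zero, sub_zero]

/-- `F_η` is even. -/
theorem F_even (x : ℝ) : F ρ η (-x) = F ρ η x := by
  simp [F, add_comm]

/-- `F_η(0) = 0`. -/
theorem F_zero (hη : 0 < η) : F ρ η 0 = 0 := by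
  simp [F, G_of_neg hη le_rfl]

/-- On `(0, ∞)`, `F_η = G_η`. -/
theorem F_of_pos {x : ℝ} (hη : 0 < η) (hx : 0 < x) : F ρ η x = G ρ η x := by
  simp [F, G_of_neg hη (neg_nonpos.2 hx.le)]

/-- `F_η` is supported in `[-1, 1] ⊆ [-λ, λ]` for `λ ≥ 1`. -/
theorem support_F (hη : 0 < η) {lam : ℝ} (hlam : 1 ≤ lam) :
    Function.support (F ρ η) ⊆ Set.Icc (-lam) lam := by
  intro x hx
  rw [Function.mem_support] at hx
  by_contra h
  simp only [Set.mem_Icc, not_and_or, not_le] at h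
  apply hx
  rcases h with h | h
  · have : F ρ η (-x) = 0 := by
      rw [F_of_pos hη (by linarith), G_of_gt_one (by linarith)]
    rwa [F_even] at this
  · rw [F_of_pos hη (by linarith), G_of_gt_one (by linarith)]

/-- Pointwise bound `‖m_{a,b}(x)‖ ≤ a^{-1/2}` for `Re ρ = 1/2`, `a > 0`. -/
theorem norm_mono_le {a b x : ℝ} (ha : 0 < a) (hρ : ρ.re = 1 / 2) :
    ‖mono ρ a b x‖ ≤ a ^ (-(1 / 2 : ℝ)) := by
  unfold mono
  split_ifs with h
  · have hx : 0 < x := ha.trans_le h.1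
    rw [Complex.norm_cpow_eq_rpow_re_of_pos hx, neg_re, hρ]
    exact Real.rpow_le_rpow_of_nonpos ha h.1 (by norm_num)
  · simp only [norm_zero]; positivity

end basic

/-! ## The lattice sum of a monomial piece is a difference of partial sums -/

section sums

variable {ρ : ℂ}

/-- `Σ_{P ≤ n ≤ Q} n^{-ρ} = A(Q) - A(P - 1)` for `1 ≤ P`, `P - 1 ≤ Q`. -/
theorem sum_Icc_cpow_eq_A_sub (P Q : ℕ) (hP : 1 ≤ P) (hPQ : P - 1 ≤ Q) :
    ∑ n ∈ Finset.Icc P Q, (n : ℂ) ^ (-ρ) = A ρ Q - A ρ (P - 1) := by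
  unfold A
  have h : Finset.Icc 1 Q = Finset.Icc 1 (P - 1) ∪ Finset.Icc P Q := by
    ext n; simp only [Finset.mem_union, Finset.mem_Icc]; omega
  rw [h, Finset.sum_union]
  · ring
  · rw [Finset.disjoint_left]
    intro n hn hn'
    simp only [Finset.mem_Icc] at hn hn'
    omega

/-- For `u > 0`, `0 < a`, and `N ≥ ⌊b/u⌋`: the lattice sum of the monomial piece over `n ≤ N` is
`u^{-ρ} (A(⌊b/u⌋) - A(⌈a/u⌉ - 1))`. -/
theorem sum_mono_eq {a b u : ℝ} (hu : 0 < u) (ha : 0 < a) (hab : a ≤ b) {N : ℕ}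
    (hN : ⌊b / u⌋₊ ≤ N) :
    ∑ n ∈ Finset.Icc 1 N, mono ρ a b (n * u)
      = (u : ℂ) ^ (-ρ) * (A ρ ⌊b / u⌋₊ - A ρ (⌈a / u⌉₊ - 1)) := by
  have hfilter : ∀ n ∈ Finset.Icc 1 N,
      mono ρ a b (n * u) = if n ∈ Finset.Icc ⌈a / u⌉₊ ⌊b / u⌋₊ then (u : ℂ) ^ (-ρ) * (n : ℂ) ^ (-ρ)
        else 0 := by
    intro n hn
    have hn1 : (1 : ℝ) ≤ n := by exact_mod_cast (Finset.mem_Icc.1 hn).1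
    have hiff : (a ≤ n * u ∧ n * u ≤ b) ↔ n ∈ Finset.Icc ⌈a / u⌉₊ ⌊b / u⌋₊ := by
      rw [Finset.mem_Icc, Nat.ceil_le, Nat.le_floor_iff (div_nonneg (ha.le.trans hab) hu.le), div_le_iff₀ hu,
        le_div_iff₀ hu]
    unfold mono
    by_cases h : a ≤ n * u ∧ n * u ≤ b
    · rw [if_pos h, if_pos (hiff.1 h)]
      have : ((n : ℝ) * u : ℝ) = ((n : ℝ) : ℂ) * (u : ℂ) := by push_cast; ring
      rw [show ((↑n * u : ℝ) : ℂ) = ((n : ℝ) : ℂ) * (u : ℂ) from by push_cast; ring,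
        Complex.mul_cpow_ofReal_nonneg (by positivity) hu.le]
      push_cast; ring
    · rw [if_neg h, if_neg (fun h' ↦ h (hiff.2 h'))]
  rw [Finset.sum_congr rfl hfilter, ← Finset.sum_filter, ← Finset.mul_sum]
  have hset : (Finset.Icc 1 N).filter (fun n ↦ n ∈ Finset.Icc ⌈a / u⌉₊ ⌊b / u⌋₊)
      = Finset.Icc ⌈a / u⌉₊ ⌊b / u⌋₊ := by
    ext n
    simp only [Finset.mem_filter, Finset.mem_Icc]
    constructor
    · rintro ⟨-, h⟩; exact h
    · rintro ⟨h1, h2⟩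
      refine ⟨⟨?_, h2.trans hN⟩, h1, h2⟩
      have : 1 ≤ ⌈a / u⌉₊ := Nat.one_le_ceil_iff.2 (by positivity)
      omega
  rw [hset, sum_Icc_cpow_eq_A_sub]
  · exact Nat.one_le_ceil_iff.2 (by positivity)
  · -- `⌈a/u⌉ - 1 < a/u ≤ b/u`, hence `≤ ⌊b/u⌋`
    have h1 : ((⌈a / u⌉₊ - 1 : ℕ) : ℝ) < a / u := by
      have hc : 1 ≤ ⌈a / u⌉₊ := Nat.one_le_ceil_iff.2 (by positivity)
      rw [Nat.cast_sub hc, Nat.cast_one]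
      linarith [Nat.ceil_lt_add_one (show 0 ≤ a / u by positivity)]
    have h2 : ((⌈a / u⌉₊ - 1 : ℕ) : ℝ) ≤ b / u :=
      h1.le.trans (div_le_div_of_nonneg_right hab hu.le)
    exact Nat.le_floor h2

/-- The dilation sum of the witness below (and on) the window: for `0 < u`, `λ ≥ 1`,
`θ_{F_η}(u) = u^{-ρ} [ (A(⌊1/u⌋) - A(⌈η/u⌉ - 1)) - κ_η (A(⌊1/u⌋) - A(⌈(1/2)/u⌉ - 1)) ]`. -/
theorem dilationSum_F {η lam u : ℝ} (hη : 0 < η) (hη2 : η ≤ 1 / 2) (hlam : 1 ≤ lam) (hu : 0 < u) :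
    dilationSum lam (F ρ η) u
      = (u : ℂ) ^ (-ρ) * ((A ρ ⌊1 / u⌋₊ - A ρ (⌈η / u⌉₊ - 1))
          - kappa ρ η * (A ρ ⌊1 / u⌋₊ - A ρ (⌈(1 / 2) / u⌉₊ - 1))) := by
  unfold dilationSum
  have hN : ⌊1 / u⌋₊ ≤ ⌊lam / u⌋₊ := Nat.floor_le_floor (div_le_div_of_nonneg_right hlam hu.le)
  have h1 : ∀ n ∈ Finset.Icc 1 ⌊lam / u⌋₊, F ρ η (n * u) = G ρ η (n * u) := by
    intro n hn
    have hn1 : (1 : ℝ) ≤ n := by exact_mod_cast (Finset.mem_Icc.1 hn).1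
    exact F_of_pos hη (by positivity)
  rw [Finset.sum_congr rfl h1]
  simp only [G, Finset.sum_sub_distrib, ← Finset.mul_sum]
  rw [sum_mono_eq hu hη (by linarith) hN, sum_mono_eq hu (by norm_num) (by norm_num) hN]
  ring

end sums

/-! ## FACT Z: Titchmarsh (4.11.1) at a zero on the critical line -/

section factZ

/-- Hardy's theorem (tree) supplies a zero `ρ` of `ζ` with `Re ρ = 1/2`; its ordinate is non-zero
because `ζ(σ) ≠ 0` for real `σ ∈ (0,1)` (tree). -/
theorem exists_criticalZero :
    ∃ ρ : ℂ, riemannZeta ρ = 0 ∧ ρ.re = 1 / 2 ∧ ρ.im ≠ 0 := by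
  obtain ⟨γ, hγ⟩ :=
    Literature.NumberTheory.LFunctions.hardy_infinite_zeros_on_critical_line_holds.nonempty
  have hγ' : riemannZeta (1 / 2 + (γ : ℂ) * I) = 0 := hγ
  refine ⟨1 / 2 + γ * I, hγ', by simp, ?_⟩
  intro him
  have hγ0 : γ = 0 := by simpa using him
  rw [hγ0, Complex.ofReal_zero, zero_mul, add_zero] at hγ'
  have hne := Literature.NumberTheory.LFunctions.riemannZeta_ofReal_ne_zero_of_pos_of_lt_one
    (1 / 2) (by norm_num) (by norm_num)
  refine hne ?_
  rw [show (((1 / 2 : ℝ)) : ℂ) = 1 / 2 by push_cast; ring]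
  exact hγ'

variable {ρ : ℂ}

/-- `N_γ = ⌈|γ|/4⌉`, the threshold of (4.11.1). -/
def Nγ (ρ : ℂ) : ℕ := ⌈|ρ.im| / 4⌉₊

/-- `C_K = 6√2·0 + …`: the uniform constant in the remainder bounds (`6√2 + 3 N_γ^{3/2}` would do; we
use the cruder `9 + 3 (N_γ + 1)²`). -/
def CK (ρ : ℂ) : ℝ := 9 + 3 * ((Nγ ρ : ℝ) + 1) ^ 2

/-- `C_K > 0`. -/
theorem CK_pos : 0 < CK ρ := by unfold CK; positivity

/-- `‖n^{-ρ}‖ ≤ 1` for `n ≥ 1`, `Re ρ = 1/2`; hence `‖A(N)‖ ≤ N`. -/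
theorem norm_A_le (hre : ρ.re = 1 / 2) (N : ℕ) : ‖A ρ N‖ ≤ N := by
  unfold A
  calc ‖∑ n ∈ Finset.Icc 1 N, (n : ℂ) ^ (-ρ)‖ ≤ ∑ n ∈ Finset.Icc 1 N, ‖(n : ℂ) ^ (-ρ)‖ :=
        norm_sum_le _ _
    _ ≤ ∑ _n ∈ Finset.Icc 1 N, (1 : ℝ) := by
        refine Finset.sum_le_sum fun n hn ↦ ?_
        have hn1 : (1 : ℝ) ≤ n := by exact_mod_cast (Finset.mem_Icc.1 hn).1
        rw [show ((n : ℕ) : ℂ) = ((n : ℝ) : ℂ) by push_cast; rfl,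
          Complex.norm_cpow_eq_rpow_re_of_pos (by linarith), neg_re, hre]
        exact Real.rpow_le_one_of_one_le_of_nonpos hn1 (by norm_num)
    _ = N := by simp

/-- FACT Z (Titchmarsh (4.11.1) at the zero): `‖A(N) - N^{1-ρ}/(1-ρ)‖ ≤ 6 N^{-1/2}` for
`N ≥ max(1, |γ|/4)`. [cite: Titchmarsh1986, Theorem 4.11, eq. (4.11.1)] -/
theorem norm_A_sub_main_le (h0 : riemannZeta ρ = 0) (hre : ρ.re = 1 / 2) (him : ρ.im ≠ 0)
    {N : ℕ} (hN : 1 ≤ N) (hγ : |ρ.im| ≤ 4 * N) :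
    ‖A ρ N - (N : ℂ) ^ (1 - ρ) / (1 - ρ)‖ ≤ 6 * (N : ℝ) ^ (-(1 / 2 : ℝ)) := by
  have h := Literature.NumberTheory.LFunctions.norm_zeta_sub_sum_add_le_uniform
    (s := ρ) (by rw [hre]; norm_num) (by rw [hre]; norm_num) him hN hγ
  rw [h0, zero_sub, hre] at h
  unfold A
  rwa [show -∑ n ∈ Finset.Icc 1 N, (n : ℂ) ^ (-ρ) + (N : ℂ) ^ (1 - ρ) / (1 - ρ)
      = -(∑ n ∈ Finset.Icc 1 N, (n : ℂ) ^ (-ρ) - (N : ℂ) ^ (1 - ρ) / (1 - ρ)) by ring,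
    norm_neg] at h

/-- `‖1 - ρ‖ ≥ 1/2`, so `‖(1-ρ)⁻¹‖ ≤ 2`. -/
theorem norm_one_sub_ge (hre : ρ.re = 1 / 2) : 1 / 2 ≤ ‖1 - ρ‖ := by
  have : (1 - ρ).re = 1 / 2 := by rw [sub_re, one_re, hre]; norm_num
  calc (1 / 2 : ℝ) = |(1 - ρ).re| := by rw [this]; norm_num
    _ ≤ ‖1 - ρ‖ := Complex.abs_re_le_norm _

/-- `1 - ρ ≠ 0` when `Re ρ = 1/2`. -/
theorem one_sub_ne_zero (hre : ρ.re = 1 / 2) : 1 - ρ ≠ 0 := by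
  intro h; have := norm_one_sub_ge hre; rw [h, norm_zero] at this; linarith

/-- Uniform remainder bound: `‖A(N) - N^{1-ρ}/(1-ρ)‖ ≤ 3 N_γ + 3` for ALL `N` (trivial below the
threshold, FACT Z above it). -/
theorem norm_A_sub_main_le_const (h0 : riemannZeta ρ = 0) (hre : ρ.re = 1 / 2) (him : ρ.im ≠ 0)
    (N : ℕ) : ‖A ρ N - (N : ℂ) ^ (1 - ρ) / (1 - ρ)‖ ≤ 3 * (Nγ ρ : ℝ) + 6 := by
  rcases Nat.eq_zero_or_pos N with rfl | hN
  · simp [A, Complex.zero_cpow (one_sub_ne_zero hre)]; positivity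
  by_cases hγ : |ρ.im| ≤ 4 * N
  · refine (norm_A_sub_main_le h0 hre him hN hγ).trans ?_
    have : (N : ℝ) ^ (-(1 / 2 : ℝ)) ≤ 1 :=
      Real.rpow_le_one_of_one_le_of_nonpos (by exact_mod_cast hN) (by norm_num)
    nlinarith [Nat.cast_nonneg (α := ℝ) (Nγ ρ)]
  · -- below the threshold: `N < |γ|/4 ≤ N_γ`
    rw [not_le] at hγ
    have hNle : (N : ℝ) ≤ Nγ ρ := by
      have : (N : ℝ) ≤ |ρ.im| / 4 := by linarith
      exact this.trans (Nat.le_ceil _)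
    calc ‖A ρ N - (N : ℂ) ^ (1 - ρ) / (1 - ρ)‖
        ≤ ‖A ρ N‖ + ‖(N : ℂ) ^ (1 - ρ) / (1 - ρ)‖ := norm_sub_le _ _
      _ ≤ N + 2 * N := by
          refine add_le_add (norm_A_le hre N) ?_
          rw [norm_div, show ((N : ℕ) : ℂ) = ((N : ℝ) : ℂ) by push_cast; rfl,
            Complex.norm_cpow_eq_rpow_re_of_pos (by exact_mod_cast hN), sub_re, one_re, hre]
          rw [div_le_iff₀ (by linarith [norm_one_sub_ge hre])]
          have h1 : (N : ℝ) ^ ((1 : ℝ) - 1 / 2) ≤ (N : ℝ) := by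
            have : (N : ℝ) ^ ((1 : ℝ) - 1 / 2) ≤ (N : ℝ) ^ (1 : ℝ) :=
              Real.rpow_le_rpow_of_exponent_le (by exact_mod_cast hN) (by norm_num)
            simpa using this
          nlinarith [norm_one_sub_ge hre, Nat.cast_nonneg (α := ℝ) N]
      _ ≤ 3 * (Nγ ρ : ℝ) + 6 := by linarith

end factZ

end LatticeUncertainty

end Summit.RiemannHypothesis.RiemannHypothesis.Theorems
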